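import Summits.Langlands.Langlands.Theses.RamifiedCoefficientSeed
import Summits.Langlands.Langlands.Theorems.SectorComplement.Negative.RamifiedCoefficientSeedSectorComplementPosition

/-!
# Equivalence audit — logical POSITION of `RamifiedCoefficientSeed.AdjointLiftingGL3` (stmt-Langlands-16779)

Crux-strategist seat `cstrat-stmt-Langlands-16779-q1` (suspect = equivalence), 2026-08-17.
Trigger: the landed `Theorems.ramifiedCoefficientSeed_langlands_iff_engine_and_frame`
(`(h1 : ExplicitRamifiedFamily) (h2 : AdjointSeedFromDuality) : Langlands ↔ AdjointLiftingGL3 ∧ SectorComplement`).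

Write `A := AdjointLiftingGL3` (the engine crux), `C := SectorComplement := X → S` (the declared out-of-scope
remainder), `X := NonPolarisableFamilyAutomorphic` (route target), `S := _root_.Langlands`.
Nothing below asserts A, C, X, S or a sibling; every statement is an implication / conditional equivalence.

* `WeakB3Q` — direction (B) of the summit at `n = 3`, `F = ℚ`, in the weak (a.e.-Satake) form, for EVERY
  irreducible, a.e.-unramified `ρ` de Rham above `p` for Fontaine's pinned datum: a named proper FRAGMENT of S
  (no direction (A), no `n ≠ 3`, no `F ≠ ℚ`, no local–global compatibility, no uniqueness).
* `weakB3Q_of_langlands : S → WeakB3Q`, `adjointLiftingGL3_of_weakB3Q : WeakB3Q → A` (the seed, the labelled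
  weights `{0,1,2}` — beyond crystalline ⇒ de Rham — and `11 ≤ p` are UNUSED): so `S → WeakB3Q → A`, i.e. A is
  the restriction of the fragment `WeakB3Q` to the regular, residually-big-image, adjoint-odd-seeded locus
  (the Taylor–Wiles/ACC+-accessible locus).
* `langlands_iff_adjointLiftingGL3_of_siblings : h1 → h2 → C → (S ↔ A)` — the flagged equivalence in its
  sharpest form: it needs ALL THREE siblings, and
* `adjointLiftingGL3_imp_langlands_iff_imp_sectorComplement : h1 → h2 → ((A → S) ↔ (A → C))` — given the two
  CONDITIONING siblings only, the missing converse `A → S` is literally "the frame C under A": proving A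
  summit-equivalent in the tree means proving the rest of the summit (C) from A.  The frame is open,
  summit-hard by construction and never staffed, so the equivalence can never become unconditional short of S.
* `example : h1 → h2 → A → X` (inner logic of `closes`) and `adjointLiftingGL3_iff_langlands_iff :
  (A ↔ S) ↔ (A → S)` (bookkeeping, since `S → A`).  `S → A`, `S → C`, cruxes `→ X` are `example`s, not decls.
-/

set_option linter.dupNamespace false

noncomputable section

namespace Summit.Langlands.Langlands.Cruxes.AdjointLiftingGL3.EquivalenceAudit

open Summit.Langlands.Langlands.Theses.RamifiedCoefficientSeed
open Summit.Langlands.Langlands.Theorems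
open Literature.NumberTheory.GaloisRepresentations Literature.NumberTheory.Automorphic

/-- **Direction (B) at `n = 3`, `F = ℚ`, weak (a.e.-Satake) form**: every irreducible `ρ : Γ_ℚ → GL₃(ℚ̄_p)`,
unramified a.e. and de Rham above `p` for Fontaine's pinned datum, has for every `ι`, `hcpt` an L-algebraic
cuspidal `π` on `GL₃(𝔸_ℚ)` with Satake–Frobenius matching a.e.  A proper fragment of the summit
(Fontaine–Mazur–Langlands for `GL₃/ℚ`, existence half only). [cite: FontaineMazurGeometric1995, Conj. 1]
[cite: BuzzardGeeLMS2014, Conj. 3.2.2] -/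
def WeakB3Q : Prop :=
  ∀ (p : ℕ) [Fact p.Prime] (ρ : FramedGaloisRep ℚ (PadicAlgCl p) 3),
    ρ.toGaloisRep.IsIrreducible →
    (∀ᶠ v : IsDedekindDomain.HeightOneSpectrum (NumberField.RingOfIntegers ℚ) in Filter.cofinite,
      ρ.IsUnramifiedAt v) →
    (∀ (v : IsDedekindDomain.HeightOneSpectrum (NumberField.RingOfIntegers ℚ))
      (hv : ((p : ℕ) : NumberField.RingOfIntegers ℚ) ∈ v.asIdeal),
      (Literature.NumberTheory.PAdicHodge.fontainePstAdicCompletion v p hv).IsDeRhamFramed (ρ.toLocal v)) →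
    ∀ (ι : PadicAlgCl p ≃+* ℂ) (hcpt : isCompact_glFiniteIntegralLevel 3 ℚ),
      ∃ π : CuspidalAutomorphicRepData 3 ℚ hcpt, π.1.IsLAlgebraic ∧
        ∀ᶠ v : IsDedekindDomain.HeightOneSpectrum (NumberField.RingOfIntegers ℚ) in Filter.cofinite,
          Summit.Langlands.SatakeFrobCompatibleAt ι π.1 ρ v

/-- `S → WeakB3Q` (direction (B) at `n = 3`, `F = ℚ`; `𝓡` from the `Nonempty` conjunct, `𝓡.pst` is the pinned
datum by definition, `Corresponds.1` is the a.e.-Satake clause). [folklore] -/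
theorem weakB3Q_of_langlands (hL : _root_.Langlands) : WeakB3Q := by
  intro p _ ρ hirr hunr hdR ι hcpt
  by_contra hno
  exact ramifiedCoefficientSeed_not_langlands_of_not_weakB_rank3 p ρ hirr hunr hdR ι hcpt hno hL

/-- `WeakB3Q → A`: the engine crux is the fragment `WeakB3Q` restricted to its locus — residual absolute
irreducibility over `ℚ(ζ_p)` gives irreducibility, crystalline gives de Rham; the odd adjoint seed, the
labelled weights `{0,1,2}` and `11 ≤ p` are NOT used. [folklore] -/
theorem adjointLiftingGL3_of_weakB3Q (h : WeakB3Q) : AdjointLiftingGL3 := by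
  intro p _ _h11 ρ hunr hcrys hirr _hseed ι hcpt
  exact h p ρ (ramifiedCoefficientSeed_isIrreducible_of_isResiduallyAbsIrreducible ρ hirr) hunr
    (fun v hv ↦ (hcrys v hv).1.isDeRhamFramed) ι hcpt

/-- `S → A` through the named fragment (= the refuter's `SofC.lean` / the strategist's
`rcs_adjointLiftingGL3_of_langlands` / contrapositive of the landed
`ramifiedCoefficientSeed_not_langlands_of_not_adjointLiftingGL3`).  An `example`, deliberately not a declaration:
a crux-store file must not carry a decl of shape `… → <route item>` that a file audit could class `proof-of-item`. -/
example (hL : _root_.Langlands) : AdjointLiftingGL3 :=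
  adjointLiftingGL3_of_weakB3Q (weakB3Q_of_langlands hL)

/-- Inner logic of the route's `closes`: the three ranked cruxes give the TARGET `X` (an `example`, same reason). -/
example (h1 : ExplicitRamifiedFamily) (h2 : AdjointSeedFromDuality) (h3 : AdjointLiftingGL3) :
    NonPolarisableFamilyAutomorphic := by
  obtain ⟨p, hp, h11, f, hne, hf⟩ := h1
  refine ⟨p, hp, h11, f, hne, fun n => (hf n).1, fun n ι hcpt => ?_⟩
  obtain ⟨_hnsd, hunr, hcrys, hdual, hirr, hcc⟩ := hf n
  exact h3 p h11 (f n) hunr hcrys hirr (h2 p (le_trans (by norm_num) h11) (f n) hdual hirr hcc) ι hcpt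

/-- **The flagged equivalence, sharpest form**: given ALL THREE siblings (the explicit family, the lever AND
the frame), `S ↔ A`.  (`→` unconditional; `←` is `closes`.) [folklore] -/
theorem langlands_iff_adjointLiftingGL3_of_siblings (h1 : ExplicitRamifiedFamily) (h2 : AdjointSeedFromDuality)
    (h4 : SectorComplement) : _root_.Langlands ↔ AdjointLiftingGL3 :=
  ⟨fun hL ↦ adjointLiftingGL3_of_weakB3Q (weakB3Q_of_langlands hL), fun h3 ↦ closes h1 h2 h3 h4⟩

/-- **Where the converse lives**: given only the two CONDITIONING siblings `h1`, `h2` (the `conditional_on`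
of the ledger flag), `A → S` holds iff `A → C` — the missing direction is exactly the frame `C` (the declared
rest of the summit) under `A`. [folklore] -/
theorem adjointLiftingGL3_imp_langlands_iff_imp_sectorComplement (h1 : ExplicitRamifiedFamily)
    (h2 : AdjointSeedFromDuality) :
    (AdjointLiftingGL3 → _root_.Langlands) ↔ (AdjointLiftingGL3 → SectorComplement) :=
  ⟨fun h h3 _ ↦ h h3, fun h h3 ↦ closes h1 h2 h3 (h h3)⟩

/-- Bookkeeping: since `S → A` unconditionally, "`A` is summit-equivalent" is the same as "`A → S`". [folklore] -/
theorem adjointLiftingGL3_iff_langlands_iff :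
    (AdjointLiftingGL3 ↔ _root_.Langlands) ↔ (AdjointLiftingGL3 → _root_.Langlands) :=
  ⟨fun h ↦ h.1, fun h ↦ ⟨h, fun hL ↦ adjointLiftingGL3_of_weakB3Q (weakB3Q_of_langlands hL)⟩⟩

/-- … hence, given `h1`, `h2`: `(A ↔ S) ↔ (A → C)`. [folklore] -/
theorem adjointLiftingGL3_iff_langlands_iff_imp_sectorComplement (h1 : ExplicitRamifiedFamily)
    (h2 : AdjointSeedFromDuality) :
    (AdjointLiftingGL3 ↔ _root_.Langlands) ↔ (AdjointLiftingGL3 → SectorComplement) :=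
  adjointLiftingGL3_iff_langlands_iff.trans (adjointLiftingGL3_imp_langlands_iff_imp_sectorComplement h1 h2)

/-- And the frame itself is summit-implied (it discards its hypothesis), so under `S` everything collapses —
the expected truth-table of an engine ∧ frame split (an `example`, same reason). -/
example (hL : _root_.Langlands) : SectorComplement := fun _ ↦ hL

/-- The trigger theorem, recovered: given the two conditioning siblings, `S ↔ A ∧ C`. [folklore] -/
theorem langlands_iff_engine_and_frame' (h1 : ExplicitRamifiedFamily) (h2 : AdjointSeedFromDuality) :
    _root_.Langlands ↔ AdjointLiftingGL3 ∧ SectorComplement :=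
  ramifiedCoefficientSeed_langlands_iff_engine_and_frame h1 h2

end Summit.Langlands.Langlands.Cruxes.AdjointLiftingGL3.EquivalenceAudit

end
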